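import Mathlib
import Summits.NavierStokesRegularity.NavierStokesRegularity.Theorems.WakeRatchetTailRatchetDyadicTypeIRate
import HarnessLib

/-!
# `WakeRatchet.TailRatchet` (stmt-NavierStokesRegularity-21808), door D4′ — Cauchy side:
# POSITIVITY PRESERVATION of the full non-negative dyadic lattice, and the type-I bound /
# blow-up horizon read from the DATA

Def-free support lemmas for the aside crux `TailRatchet` (route `WakeRatchet`).  MODEL lattice ODEs only
(the scalar dyadic / Katz–Pavlović chain `Ẋₙ = Λⁿ⁻¹ Xₙ₋₁² − Λⁿ Xₙ Xₙ₊₁` of Tao 2016 §1.2 / §4, `m = 1`);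
nothing in this file is a statement about the Navier–Stokes equations; stmt-21808 is neither proved nor
refuted here and no stub of skeleton d00b85951d7c is closed.

WHY.  The census of the item (hands g11–g14) reduces the refutation of `TailRatchet` through door D4′ to
a-priori facts about the non-negative dyadic CAUCHY blow-up.  The type-I rate `typeI_dyadic`
(`…DyadicTypeIRate`) is stated at an instant `t₀` at which the shells above the anchor are non-negative.
On the Cauchy side that sign hypothesis must come from the DATA: this file proves that non-negativity
propagates forward along every solution of the ℤ-indexed lattice (no truncation, no regularity and no
summability hypothesis — each shell solves a scalar linear equation with a non-negative source), and
packages the consequences: the type-I bound at EVERY later instant and every shell above the anchor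
(the «uniform bound» of the recentred frames `W_n(σ) = Λⁿ(T − t)Xₙ(t)` on the whole interval of
regularity), and the finite REGULARITY HORIZON `T − t₀ ≤ 2Λ²/((Λ−1)² Λᴹ X_M(t₀))` from any positive
datum shell — finite-time loss of regularity of every non-trivial non-negative regular solution, for
every `Λ > 1` (Katz–Pavlović 2005 / Kiselev–Zlatoš 2005 / Cheskidov 2008 prove blow-up through weighted
`Hˢ` functionals; here it is the instant Riccati functional of `…DyadicTypeI` plus positivity).

CONTENTS (all def-free):
* `exp_integral_mul_monotoneOn` / `nonneg_of_linear_nonneg_source` / `pos_of_linear_nonneg_source` —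
  the scalar integrating factor: `x' = q − c·x` on `[t₀, t]` with `q ≥ 0`, `c` continuous ⇒
  `u ↦ exp(∫_{t₀}^u c)·x(u)` is non-decreasing, so `x(t₀) ≥ 0 ⇒ x(t) ≥ 0` and `x(t₀) > 0 ⇒ x(t) > 0`.
* `dyadic_nonneg` / `dyadic_pos` — POSITIVITY PRESERVATION for the lattice `Ẋₙ = Λⁿ⁻¹Xₙ₋₁² − ΛⁿXₙXₙ₊₁`
  solved on `(a, T)` at every shell `n ≥ N` (`Λ ≥ 0`; the shell `N − 1` below the anchor is an
  arbitrary differentiable-free real feed, entering only through its square): `Xₙ(t₀) ≥ 0` for `n ≥ N`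
  ⇒ `Xₙ(t) ≥ 0` on `[t₀, T)` for `n ≥ N`; strict positivity of a shell is preserved too.
* `typeI_dyadic_of_nonneg_data` — `Λ > 1`, regular family above `N − 1`, non-negative data above `N` at
  `t₀` ⇒ `(T − t)·Λᴹ X_M(t) ≤ 2Λ²/(Λ−1)²` for EVERY `M ≥ N` and EVERY `t ∈ [t₀, T)`.
* `frame_bound_of_nonneg_data` — the same as the two-sided frame bound
  `0 ≤ Λᴹ X_M(t)(T − t) ≤ 2Λ²/(Λ−1)²`.
* `regularity_horizon_le` — `X_M(t₀) > 0` for some `M ≥ N` ⇒ `T − t₀ ≤ 2Λ²/((Λ−1)² Λᴹ X_M(t₀))`: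
  a non-negative solution that is regular on `(a, T)` above shell `N − 1` cannot have
  `T > t₀ + 2Λ²/((Λ−1)² Λᴹ X_M(t₀))`.

HONEST FRAMING: elementary real analysis on the lemma layer; the remaining Cauchy-side inputs of door
D4′ (local existence of regular solutions in `ℓ^∞_Λ`, per-shell action (M), post-firing decay (D),
pre-firing quietness (Q), the extraction) are NOT addressed; rung 0.
-/

noncomputable section

set_option linter.dupNamespace false

namespace Summit.NavierStokesRegularity.NavierStokesRegularity.Theorems

namespace WakeRatchetDyadicPositivity

open Set Filter Topology MeasureTheory intervalIntegral
open WakeRatchetDyadicTypeI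

/-! ## The scalar integrating factor -/

/-- **Integrating factor.**  If `x' = q − c·x` on `[t₀, t]` (two-sided derivatives), `c` is continuous
on `[t₀, t]` and `q ≥ 0` there, then `u ↦ exp(∫_{t₀}^u c̃)·x(u)` is non-decreasing on `[t₀, t]`, where
`c̃ = c ∘ projIcc` is the continuous extension of `c`. [folklore] -/
theorem exp_integral_mul_monotoneOn {x q c : ℝ → ℝ} {t₀ t : ℝ} (ht : t₀ ≤ t)
    (hx : ∀ u ∈ Icc t₀ t, HasDerivAt x (q u - c u * x u) u)
    (hc : ContinuousOn c (Icc t₀ t)) (hq : ∀ u ∈ Icc t₀ t, 0 ≤ q u) :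
    MonotoneOn (fun u => Real.exp (∫ s in t₀..u, c (projIcc t₀ t ht s)) * x u) (Icc t₀ t) := by
  -- the continuous extension of `c` and its primitive
  set ce : ℝ → ℝ := fun s => c (projIcc t₀ t ht s) with hce
  have hcec : Continuous ce :=
    (continuousOn_iff_continuous_restrict.1 hc).comp continuous_projIcc
  have hceI : ∀ s ∈ Icc t₀ t, ce s = c s := fun s hs => by
    simp only [hce, projIcc_of_mem ht hs]
  set P : ℝ → ℝ := fun u => ∫ s in t₀..u, ce s with hP
  have hPd : ∀ u, HasDerivAt P (ce u) u := fun u =>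
    (hcec.integral_hasStrictDerivAt t₀ u).hasDerivAt
  -- derivative of the product
  have hψd : ∀ u ∈ Icc t₀ t, HasDerivWithinAt (fun u => Real.exp (P u) * x u)
      (Real.exp (P u) * q u) (Icc t₀ t) u := by
    intro u hu
    have h1 : HasDerivAt (fun u => Real.exp (P u)) (Real.exp (P u) * ce u) u := (hPd u).exp
    have h2 := h1.mul (hx u hu)
    refine (h2.congr_deriv ?_).hasDerivWithinAt
    rw [hceI u hu]
    ring
  refine monotoneOn_of_hasDerivWithinAt_nonneg (f' := fun u => Real.exp (P u) * q u)
    (convex_Icc t₀ t) (fun u hu => (hψd u hu).continuousWithinAt) (fun u hu => ?_) (fun u hu => ?_)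
  · rw [interior_Icc] at hu ⊢
    exact (hψd u (Ioo_subset_Icc_self hu)).mono Ioo_subset_Icc_self
  · rw [interior_Icc] at hu
    exact mul_nonneg (Real.exp_pos _).le (hq u (Ioo_subset_Icc_self hu))

/-- **Non-negativity is preserved** by `x' = q − c·x` with `q ≥ 0`, `c` continuous:
`x(t₀) ≥ 0 ⇒ x(t) ≥ 0`. [folklore] -/
theorem nonneg_of_linear_nonneg_source {x q c : ℝ → ℝ} {t₀ t : ℝ} (ht : t₀ ≤ t)
    (hx : ∀ u ∈ Icc t₀ t, HasDerivAt x (q u - c u * x u) u)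
    (hc : ContinuousOn c (Icc t₀ t)) (hq : ∀ u ∈ Icc t₀ t, 0 ≤ q u) (h0 : 0 ≤ x t₀) : 0 ≤ x t := by
  have hmono := exp_integral_mul_monotoneOn ht hx hc hq
  have h := hmono (left_mem_Icc.2 ht) (right_mem_Icc.2 ht) ht
  simp only [intervalIntegral.integral_same, Real.exp_zero, one_mul] at h
  exact (mul_nonneg_iff_of_pos_left (Real.exp_pos _)).1 (h0.trans h)

/-- **Strict positivity is preserved** by `x' = q − c·x` with `q ≥ 0`, `c` continuous:
`x(t₀) > 0 ⇒ x(t) > 0`. [folklore] -/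
theorem pos_of_linear_nonneg_source {x q c : ℝ → ℝ} {t₀ t : ℝ} (ht : t₀ ≤ t)
    (hx : ∀ u ∈ Icc t₀ t, HasDerivAt x (q u - c u * x u) u)
    (hc : ContinuousOn c (Icc t₀ t)) (hq : ∀ u ∈ Icc t₀ t, 0 ≤ q u) (h0 : 0 < x t₀) : 0 < x t := by
  have hmono := exp_integral_mul_monotoneOn ht hx hc hq
  have h := hmono (left_mem_Icc.2 ht) (right_mem_Icc.2 ht) ht
  simp only [intervalIntegral.integral_same, Real.exp_zero, one_mul] at h
  exact (mul_pos_iff_of_pos_left (Real.exp_pos _)).1 (h0.trans_le h)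

/-! ## Positivity preservation for the ℤ-indexed dyadic lattice -/

section Lattice

variable {Λ a T : ℝ} {X : ℤ → ℝ → ℝ} {N : ℤ}

/-- **POSITIVITY PRESERVATION.**  Let `Λ ≥ 0` and let `X : ℤ → ℝ → ℝ` solve
`Ẋₙ = Λⁿ⁻¹ Xₙ₋₁² − Λⁿ Xₙ Xₙ₊₁` on `(a, T)` at every shell `n ≥ N` (nothing is assumed about the
shells below `N`: the shell `N − 1` enters only through its square).  If `Xₙ(t₀) ≥ 0` for every
`n ≥ N` at some `t₀ ∈ (a, T)`, then `Xₙ(t) ≥ 0` for every `n ≥ N` and every `t ∈ [t₀, T)`.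
Proof: shell `n` solves the scalar LINEAR equation `x' = q − c x` with source `q = Λⁿ⁻¹Xₙ₋₁² ≥ 0` and
continuous coefficient `c = ΛⁿXₙ₊₁`; integrating factor (no induction over shells, no sign of `Xₙ₊₁`).
[cite: Tao2016AveragedNS, §1.2 (dyadic model), §4 Lemma 4.1 (4.8) with `m = 1`; elementary] -/
theorem dyadic_nonneg (hΛ : 0 ≤ Λ)
    (hlaw : ∀ n : ℤ, N ≤ n → ∀ t ∈ Ioo a T,
      HasDerivAt (X n) (Λ ^ (n - 1) * X (n - 1) t ^ 2 - Λ ^ n * X n t * X (n + 1) t) t)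
    {t₀ : ℝ} (ht₀ : t₀ ∈ Ioo a T) (hpos : ∀ n : ℤ, N ≤ n → 0 ≤ X n t₀) :
    ∀ n : ℤ, N ≤ n → ∀ t ∈ Ico t₀ T, 0 ≤ X n t := by
  intro n hn t ht
  have hsub : Icc t₀ t ⊆ Ioo a T := fun u hu => ⟨ht₀.1.trans_le hu.1, hu.2.trans_lt ht.2⟩
  have hx : ∀ u ∈ Icc t₀ t, HasDerivAt (X n)
      (Λ ^ (n - 1) * X (n - 1) u ^ 2 - (Λ ^ n * X (n + 1) u) * X n u) u := by
    intro u hu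
    refine (hlaw n hn u (hsub hu)).congr_deriv ?_
    ring
  have hc : ContinuousOn (fun u => Λ ^ n * X (n + 1) u) (Icc t₀ t) := by
    refine continuousOn_const.mul ?_
    intro u hu
    exact (hlaw (n + 1) (by omega) u (hsub hu)).continuousAt.continuousWithinAt
  have hq : ∀ u ∈ Icc t₀ t, 0 ≤ Λ ^ (n - 1) * X (n - 1) u ^ 2 := fun u _ =>
    mul_nonneg (zpow_nonneg hΛ _) (sq_nonneg _)
  exact nonneg_of_linear_nonneg_source ht.1 hx hc hq (hpos n hn)

/-- **Strict positivity of a shell is preserved.**  Under the hypotheses of `dyadic_nonneg`, a shell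
`n ≥ N` with `Xₙ(t₀) > 0` stays strictly positive on `[t₀, T)`.
[cite: Tao2016AveragedNS, §1.2, §4 Lemma 4.1 (4.8) with `m = 1`; elementary] -/
theorem dyadic_pos (hΛ : 0 ≤ Λ)
    (hlaw : ∀ n : ℤ, N ≤ n → ∀ t ∈ Ioo a T,
      HasDerivAt (X n) (Λ ^ (n - 1) * X (n - 1) t ^ 2 - Λ ^ n * X n t * X (n + 1) t) t)
    {t₀ : ℝ} (ht₀ : t₀ ∈ Ioo a T) {n : ℤ} (hn : N ≤ n) (hn0 : 0 < X n t₀) :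
    ∀ t ∈ Ico t₀ T, 0 < X n t := by
  intro t ht
  have hsub : Icc t₀ t ⊆ Ioo a T := fun u hu => ⟨ht₀.1.trans_le hu.1, hu.2.trans_lt ht.2⟩
  have hx : ∀ u ∈ Icc t₀ t, HasDerivAt (X n)
      (Λ ^ (n - 1) * X (n - 1) u ^ 2 - (Λ ^ n * X (n + 1) u) * X n u) u := by
    intro u hu
    refine (hlaw n hn u (hsub hu)).congr_deriv ?_
    ring
  have hc : ContinuousOn (fun u => Λ ^ n * X (n + 1) u) (Icc t₀ t) := by
    refine continuousOn_const.mul ?_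
    intro u hu
    exact (hlaw (n + 1) (by omega) u (hsub hu)).continuousAt.continuousWithinAt
  have hq : ∀ u ∈ Icc t₀ t, 0 ≤ Λ ^ (n - 1) * X (n - 1) u ^ 2 := fun u _ =>
    mul_nonneg (zpow_nonneg hΛ _) (sq_nonneg _)
  exact pos_of_linear_nonneg_source ht.1 hx hc hq hn0

/-! ## The type-I bound and the regularity horizon from non-negative data -/

/-- **TYPE-I RATE FROM NON-NEGATIVE DATA.**  Let `Λ > 1` and let `X` solve the dyadic law on `(a, T)`
at every shell `n ≥ N`, regular on every `(a, T′)`, `T′ < T`, above shell `N − 1`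
(`Λⁿ|Xₙ| ≤ B(T′)` there), with non-negative data above the anchor at `t₀ ∈ (a, T)`.  Then at EVERY
later instant `t ∈ [t₀, T)` and EVERY shell `M ≥ N`:  `(T − t)·Λᴹ X_M(t) ≤ 2Λ²/(Λ−1)²`.
(`typeI_dyadic` at the anchor `M`, its sign hypothesis discharged by `dyadic_nonneg`.)
[cite: Tao2016AveragedNS, §1.2, §4 Lemma 4.1 (4.8) with `m = 1`; elementary] -/
theorem typeI_dyadic_of_nonneg_data (hΛ : 1 < Λ)
    (hlaw : ∀ n : ℤ, N ≤ n → ∀ t ∈ Ioo a T,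
      HasDerivAt (X n) (Λ ^ (n - 1) * X (n - 1) t ^ 2 - Λ ^ n * X n t * X (n + 1) t) t)
    (hreg : ∀ T', T' < T → ∃ B : ℝ, ∀ n : ℤ, N - 1 ≤ n → ∀ t ∈ Ioo a T', |Λ ^ n * X n t| ≤ B)
    {t₀ : ℝ} (ht₀ : t₀ ∈ Ioo a T) (hpos : ∀ n : ℤ, N ≤ n → 0 ≤ X n t₀)
    {M : ℤ} (hM : N ≤ M) {t : ℝ} (ht : t ∈ Ico t₀ T) :
    (T - t) * (Λ ^ M * X M t) ≤ 2 * Λ ^ 2 / (Λ - 1) ^ 2 := by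
  have ht' : t ∈ Ioo a T := ⟨ht₀.1.trans_le ht.1, ht.2⟩
  refine typeI_dyadic hΛ (N := M) (fun n hn => hlaw n (hM.trans hn))
    (fun T' hT' => ?_) ht' (fun n hn => ?_)
  · obtain ⟨B, hB⟩ := hreg T' hT'
    exact ⟨B, fun n hn => hB n (by omega)⟩
  · exact dyadic_nonneg (by linarith) hlaw ht₀ hpos n (by omega) t ht

/-- **Two-sided frame bound.**  Under the hypotheses of `typeI_dyadic_of_nonneg_data`, the recentred
frame amplitude of every shell `M ≥ N` obeys `0 ≤ Λᴹ X_M(t)·(T − t) ≤ 2Λ²/(Λ−1)²` on `[t₀, T)` — the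
«uniform bound» of the frames `W_M(σ) = Λᴹ(T − t)X_M(t)` of door D4′ on the whole interval of
regularity, read from the data.
[cite: Tao2016AveragedNS, §1.2, §4 Lemma 4.1 (4.8) with `m = 1`, §6.4 (renormalised frames); elementary] -/
theorem frame_bound_of_nonneg_data (hΛ : 1 < Λ)
    (hlaw : ∀ n : ℤ, N ≤ n → ∀ t ∈ Ioo a T,
      HasDerivAt (X n) (Λ ^ (n - 1) * X (n - 1) t ^ 2 - Λ ^ n * X n t * X (n + 1) t) t)
    (hreg : ∀ T', T' < T → ∃ B : ℝ, ∀ n : ℤ, N - 1 ≤ n → ∀ t ∈ Ioo a T', |Λ ^ n * X n t| ≤ B)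
    {t₀ : ℝ} (ht₀ : t₀ ∈ Ioo a T) (hpos : ∀ n : ℤ, N ≤ n → 0 ≤ X n t₀)
    {M : ℤ} (hM : N ≤ M) {t : ℝ} (ht : t ∈ Ico t₀ T) :
    0 ≤ Λ ^ M * X M t * (T - t) ∧ Λ ^ M * X M t * (T - t) ≤ 2 * Λ ^ 2 / (Λ - 1) ^ 2 := by
  have hΛ0 : 0 < Λ := by linarith
  have hX : 0 ≤ X M t := dyadic_nonneg hΛ0.le hlaw ht₀ hpos M hM t ht
  refine ⟨mul_nonneg (mul_nonneg (zpow_pos hΛ0 M).le hX) (by linarith [ht.2]), ?_⟩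
  rw [mul_comm]
  exact typeI_dyadic_of_nonneg_data hΛ hlaw hreg ht₀ hpos hM ht

/-- **FINITE REGULARITY HORIZON (finite-time loss of regularity).**  Let `Λ > 1` and let `X` solve the
dyadic law on `(a, T)` at every shell `n ≥ N`, regular on every `(a, T′)`, `T′ < T`, above shell
`N − 1`, with non-negative data above the anchor at `t₀ ∈ (a, T)` and ONE shell `M ≥ N` with
`X_M(t₀) > 0`.  Then `T − t₀ ≤ 2Λ²/((Λ−1)² · Λᴹ X_M(t₀))`: no non-negative non-trivial solution stays
regular longer than that.
[cite: Tao2016AveragedNS, §1.2 (finite time blow-up of the dyadic model, Katz–Pavlović / Cheskidov), §4 Lemma 4.1 (4.8) with `m = 1`; elementary] -/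
theorem regularity_horizon_le (hΛ : 1 < Λ)
    (hlaw : ∀ n : ℤ, N ≤ n → ∀ t ∈ Ioo a T,
      HasDerivAt (X n) (Λ ^ (n - 1) * X (n - 1) t ^ 2 - Λ ^ n * X n t * X (n + 1) t) t)
    (hreg : ∀ T', T' < T → ∃ B : ℝ, ∀ n : ℤ, N - 1 ≤ n → ∀ t ∈ Ioo a T', |Λ ^ n * X n t| ≤ B)
    {t₀ : ℝ} (ht₀ : t₀ ∈ Ioo a T) (hpos : ∀ n : ℤ, N ≤ n → 0 ≤ X n t₀)
    {M : ℤ} (hM : N ≤ M) (hM0 : 0 < X M t₀) :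
    T - t₀ ≤ 2 * Λ ^ 2 / ((Λ - 1) ^ 2 * (Λ ^ M * X M t₀)) := by
  have hΛ0 : 0 < Λ := by linarith
  have hY : 0 < Λ ^ M * X M t₀ := mul_pos (zpow_pos hΛ0 M) hM0
  have h := typeI_dyadic_of_nonneg_data hΛ hlaw hreg ht₀ hpos hM ⟨le_rfl, ht₀.2⟩
  rw [le_div_iff₀ (mul_pos (pow_pos (by linarith) 2) hY)]
  have h1 : (Λ - 1) ^ 2 > 0 := pow_pos (by linarith) 2
  have hne : Λ - 1 ≠ 0 := by linarith
  calc (T - t₀) * ((Λ - 1) ^ 2 * (Λ ^ M * X M t₀))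
      = (Λ - 1) ^ 2 * ((T - t₀) * (Λ ^ M * X M t₀)) := by ring
    _ ≤ (Λ - 1) ^ 2 * (2 * Λ ^ 2 / (Λ - 1) ^ 2) := mul_le_mul_of_nonneg_left h h1.le
    _ = 2 * Λ ^ 2 := by field_simp

/-- **Contrapositive form: regularity cannot persist.**  Under the same hypotheses, if the family is
regular on every `(a, T′)`, `T′ < T`, then `T ≤ t₀ + 2Λ²/((Λ−1)² Λᴹ X_M(t₀))`; in particular there is
no such solution with `T = t₀ + 2Λ²/((Λ−1)² Λᴹ X_M(t₀)) + 1`.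
[cite: Tao2016AveragedNS, §1.2, §4 Lemma 4.1 (4.8) with `m = 1`; elementary] -/
theorem time_of_regularity_le (hΛ : 1 < Λ)
    (hlaw : ∀ n : ℤ, N ≤ n → ∀ t ∈ Ioo a T,
      HasDerivAt (X n) (Λ ^ (n - 1) * X (n - 1) t ^ 2 - Λ ^ n * X n t * X (n + 1) t) t)
    (hreg : ∀ T', T' < T → ∃ B : ℝ, ∀ n : ℤ, N - 1 ≤ n → ∀ t ∈ Ioo a T', |Λ ^ n * X n t| ≤ B)
    {t₀ : ℝ} (ht₀ : t₀ ∈ Ioo a T) (hpos : ∀ n : ℤ, N ≤ n → 0 ≤ X n t₀)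
    {M : ℤ} (hM : N ≤ M) (hM0 : 0 < X M t₀) :
    T ≤ t₀ + 2 * Λ ^ 2 / ((Λ - 1) ^ 2 * (Λ ^ M * X M t₀)) := by
  have := regularity_horizon_le hΛ hlaw hreg ht₀ hpos hM hM0
  linarith

end Lattice

end WakeRatchetDyadicPositivity

end Summit.NavierStokesRegularity.NavierStokesRegularity.Theorems

end
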